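import Summits.ValiantsHypothesis.ValiantsHypothesis.Theorems.FeketeSOSFeketeSOSHardPaleyRIPLowRankSquares
import Summits.ValiantsHypothesis.ValiantsHypothesis.Theorems.FeketeSOSFeketeSOSHardPaleyRIPIntervalFourier

/-!
# Route FeketeSOS — crux `FeketeSOSHard` (stmt-ValiantsHypothesis-3996), line `paley-rip` v3,
# `stub_tameOperator` on direct sumsets, piece 3: block decomposition along `D` and Fourier assembly

Setting of `Cruxes/FeketeSOSHard/TameOperatorDplusH.md` (§9 of the census `Lines/paley-rip-stub3-census.md`):
`S = D + H`, `H = [0,k)`, the sum DIRECT (`d + h = d' + h' ⇒ d = d'`), `N = 2k − 1`, `ζ` a primitive `N`-th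
root of unity.  A polynomial `w` supported in `S` is `Σ_{d∈D} X^d ρ_d(w)` with ROWS `ρ_d(w) = Σ_{h<k} w_{d+h} X^h`
(`eq_sum_shift_rows`), so the pattern of weighted squares `(c_i, w_i)_{i<r}` splits into blocks
`Σ_i c_i w_i² = Σ_{d,d'∈D} X^{d+d'} G_{dd'}`, `G_{dd'} = Σ_i c_i ρ_d(w_i) ρ_{d'}(w_i)` of degree `< N`
(`pattern_blocks`).  Fourier inversion of every block (`dft_inversion`) regroups the pattern BY FREQUENCY:
`Σ_i c_i w_i² = Σ_{j<N} Q_j · e_j`, `e_j = Σ_{n<N} ζ^{−jn} X^n`, `Q_j = Σ_i (c_i/N) V_{ij}²`,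
`V_{ij} = Σ_{d∈D} ρ_d(w_i)(ζ^j) X^d` — at each frequency a family of `r` weighted squares supported on `D`
(`pattern_by_frequency`).  Now `lowRank_rep` (piece 2: mass `≤ √r‖C_j‖_F`), `exp_rep` (piece (B): `e_j` costs
`≤ ⌊log₂k⌋ + 5/2` on `[0,k)`) and `rep_mul` (direct sum ⇒ proper product) give

* `directSum_rep_frobenius` — weighted squares supported in `S ⊇ D + [0,k)` with the same pattern and mass
  `≤ √r · (Nat.log 2 k + 5/2) · Σ_{j<N} ‖C_j‖_F`, `C_j = ((1/N) Σ_i c_i ρ_d(w_i)(ζ^j) ρ_{d'}(w_i)(ζ^j))_{d,d'∈D}`.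

The bound `Σ_j ‖C_j‖_F ≤ ‖pattern‖₂` (Parseval + the Sidon-type spacing of `D`) and the final statements are
in the sequel file.  Honest framing (rung currency): Theorems-side helper `--supports` stmt-3996; nothing here
closes a registered stub; `stub_tameOperator`, `stub_paleyFlatRIP` and the crux stay OPEN; `VP ≠ VNP` untouched.
-/

set_option linter.dupNamespace false

namespace Summit.ValiantsHypothesis.ValiantsHypothesis.Theorems.FeketeSOSHardPaleyRIP

open Polynomial Finset
open scoped BigOperators

noncomputable section

/-! ## Rows along a direct sumset `D + [0,k)` -/

/-- A Sidon-type spacing of `D` relative to `[0, 2k−1)` (all `d + d' + f`, `{d,d'} ⊆ D`, `f < 2k − 1`,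
distinct up to swapping `d, d'`) makes `D + [0,k)` direct. [folklore] -/
theorem direct_of_sidon (D : Finset ℕ) (k : ℕ)
    (hD : ∀ d₁ ∈ D, ∀ d₁' ∈ D, ∀ d₂ ∈ D, ∀ d₂' ∈ D, ∀ f₁ < 2 * k - 1, ∀ f₂ < 2 * k - 1,
      d₁ + d₁' + f₁ = d₂ + d₂' + f₂ → (d₁ = d₂ ∧ d₁' = d₂') ∨ (d₁ = d₂' ∧ d₁' = d₂)) :
    ∀ d ∈ D, ∀ h < k, ∀ d' ∈ D, ∀ h' < k, d + h = d' + h' → d = d' := by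
  intro d hd h hh d' hd' h' hh' heq
  rcases hD d hd d hd d hd d' hd' (2 * h) (by omega) (h + h') (by omega) (by omega) with ⟨-, h2⟩ | ⟨h1, -⟩
  · exact h2
  · exact h1

/-- Coefficients of the row `ρ_d(w) = Σ_{h<k} w_{d+h} X^h`. [folklore] -/
theorem coeff_row (w : ℂ[X]) (k d m : ℕ) :
    (∑ h ∈ range k, C (w.coeff (d + h)) * (X : ℂ[X]) ^ h).coeff m =
      if m < k then w.coeff (d + m) else 0 := by
  rw [coeff_sum_C_mul_X_pow]
  simp only [mem_range]

/-- A row has degree `≤ k − 1`. [folklore] -/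
theorem natDegree_row_le (w : ℂ[X]) (k d : ℕ) :
    (∑ h ∈ range k, C (w.coeff (d + h)) * (X : ℂ[X]) ^ h).natDegree ≤ k - 1 :=
  natDegree_sum_le_of_forall_le (range k) _ fun h hh =>
    (natDegree_C_mul_X_pow_le _ _).trans (by have := mem_range.1 hh; omega)

/-- **Row decomposition**: on a direct sumset `D + [0,k)`, `w = Σ_{d∈D} X^d ρ_d(w)`. [folklore] -/
theorem eq_sum_shift_rows (D : Finset ℕ) (k : ℕ)
    (hdirect : ∀ d ∈ D, ∀ h < k, ∀ d' ∈ D, ∀ h' < k, d + h = d' + h' → d = d')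
    (w : ℂ[X]) (hw : w.support ⊆ (D ×ˢ range k).image (fun x => x.1 + x.2)) :
    w = ∑ d ∈ D, X ^ d * ∑ h ∈ range k, C (w.coeff (d + h)) * (X : ℂ[X]) ^ h := by
  ext n
  rw [finsetSum_coeff]
  simp only [coeff_X_pow_mul', coeff_row]
  by_cases hn : n ∈ (D ×ˢ range k).image (fun x => x.1 + x.2)
  · obtain ⟨⟨d₀, h₀⟩, hx, hn0⟩ := Finset.mem_image.1 hn
    rw [Finset.mem_product, mem_range] at hx
    simp only at hn0
    rw [Finset.sum_eq_single d₀]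
    · rw [if_pos (by omega), if_pos (by omega)]
      congr 1; omega
    · intro d hd hne
      by_cases h1 : d ≤ n
      · rw [if_pos h1]
        by_cases h2 : n - d < k
        · exact absurd (hdirect d hd (n - d) h2 d₀ hx.1 h₀ hx.2 (by omega)) hne
        · rw [if_neg h2]
      · rw [if_neg h1]
    · intro h; exact absurd hx.1 h
  · have h0 : w.coeff n = 0 := notMem_support_iff.1 fun h => hn (hw h)
    rw [h0]
    refine (Finset.sum_eq_zero fun d hd => ?_).symm
    by_cases h1 : d ≤ n
    · rw [if_pos h1]
      by_cases h2 : n - d < k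
      · exact absurd (Finset.mem_image.2 ⟨(d, n - d), Finset.mem_product.2 ⟨hd, mem_range.2 h2⟩, by
          simp only; omega⟩) hn
      · rw [if_neg h2]
    · rw [if_neg h1]

/-- **Block decomposition of the pattern**: `Σ_i c_i w_i² = Σ_{d,d'∈D} X^{d+d'} Σ_i c_i ρ_d(w_i) ρ_{d'}(w_i)`.
[folklore] -/
theorem pattern_blocks (D : Finset ℕ) (k : ℕ)
    (hdirect : ∀ d ∈ D, ∀ h < k, ∀ d' ∈ D, ∀ h' < k, d + h = d' + h' → d = d')
    (r : ℕ) (c : Fin r → ℂ) (w : Fin r → ℂ[X])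
    (hw : ∀ i, (w i).support ⊆ (D ×ˢ range k).image (fun x => x.1 + x.2))
    (ρ : Fin r → ℕ → ℂ[X]) (hρ : ∀ i d, ρ i d = ∑ h ∈ range k, C ((w i).coeff (d + h)) * (X : ℂ[X]) ^ h) :
    ∑ i, C (c i) * w i ^ 2 = ∑ d ∈ D, ∑ d' ∈ D, X ^ (d + d') * ∑ i, C (c i) * (ρ i d * ρ i d') := by
  have hw' : ∀ i, w i = ∑ d ∈ D, X ^ d * ρ i d := fun i => by
    simp only [hρ]; exact eq_sum_shift_rows D k hdirect (w i) (hw i)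
  calc ∑ i, C (c i) * w i ^ 2
      = ∑ i, ∑ d ∈ D, ∑ d' ∈ D, X ^ (d + d') * (C (c i) * (ρ i d * ρ i d')) := by
        refine Finset.sum_congr rfl fun i _ => ?_
        rw [hw' i, pow_two, Finset.sum_mul_sum, Finset.mul_sum]
        refine Finset.sum_congr rfl fun d _ => ?_
        rw [Finset.mul_sum]
        refine Finset.sum_congr rfl fun d' _ => ?_
        rw [pow_add]; ring
    _ = ∑ d ∈ D, ∑ d' ∈ D, X ^ (d + d') * ∑ i, C (c i) * (ρ i d * ρ i d') := by
        rw [Finset.sum_comm]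
        refine Finset.sum_congr rfl fun d _ => ?_
        rw [Finset.sum_comm]
        refine Finset.sum_congr rfl fun d' _ => ?_
        rw [Finset.mul_sum]

/-- A block `G_{dd'} = Σ_i c_i ρ_d(w_i) ρ_{d'}(w_i)` has degree `< 2k − 1` (`k ≥ 1`). [folklore] -/
theorem natDegree_block_lt (k : ℕ) (hk : 1 ≤ k) (r : ℕ) (c : Fin r → ℂ) (w : Fin r → ℂ[X]) (d d' : ℕ)
    (ρ : Fin r → ℕ → ℂ[X]) (hρ : ∀ i d, ρ i d = ∑ h ∈ range k, C ((w i).coeff (d + h)) * (X : ℂ[X]) ^ h) :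
    (∑ i, C (c i) * (ρ i d * ρ i d')).natDegree < 2 * k - 1 := by
  have hdeg : ∀ i e, (ρ i e).natDegree ≤ k - 1 := fun i e => by rw [hρ]; exact natDegree_row_le _ _ _
  refine lt_of_le_of_lt (natDegree_sum_le_of_forall_le (n := 2 * k - 2) _ _ fun i _ => ?_) (by omega)
  refine (natDegree_C_mul_le _ _).trans ((natDegree_mul_le).trans ?_)
  have h1 := hdeg i d
  have h2 := hdeg i d'
  omega

/-- Evaluation of a block: `G_{dd'}(x) = Σ_i c_i ρ_d(w_i)(x) ρ_{d'}(w_i)(x)`. [folklore] -/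
theorem eval_block (r : ℕ) (c : Fin r → ℂ) (ρ : Fin r → ℕ → ℂ[X]) (d d' : ℕ) (x : ℂ) :
    (∑ i, C (c i) * (ρ i d * ρ i d')).eval x = ∑ i, c i * ((ρ i d).eval x * (ρ i d').eval x) := by
  rw [eval_finsetSum]
  simp only [eval_mul, eval_C]

/-- The square of a coefficient polynomial on `D`: `(Σ_{d∈D} a_d X^d)² = Σ_{d,d'∈D} a_d a_{d'} X^{d+d'}`, summed
with weights: `Σ_i c_i (Σ_d a_{id} X^d)² = Σ_{d,d'} (Σ_i c_i a_{id} a_{id'}) X^{d+d'}`. [folklore] -/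
theorem sum_C_mul_sq_coeffPoly (D : Finset ℕ) (r : ℕ) (c : Fin r → ℂ) (a : Fin r → ℕ → ℂ) :
    ∑ i, C (c i) * (∑ d ∈ D, C (a i d) * (X : ℂ[X]) ^ d) ^ 2 =
      ∑ d ∈ D, ∑ d' ∈ D, C (∑ i, c i * (a i d * a i d')) * (X : ℂ[X]) ^ (d + d') := by
  calc ∑ i, C (c i) * (∑ d ∈ D, C (a i d) * (X : ℂ[X]) ^ d) ^ 2
      = ∑ i, ∑ d ∈ D, ∑ d' ∈ D, C (c i * (a i d * a i d')) * (X : ℂ[X]) ^ (d + d') := by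
        refine Finset.sum_congr rfl fun i _ => ?_
        rw [pow_two, Finset.sum_mul_sum, Finset.mul_sum]
        refine Finset.sum_congr rfl fun d _ => ?_
        rw [Finset.mul_sum]
        refine Finset.sum_congr rfl fun d' _ => ?_
        rw [pow_add, map_mul, map_mul]; ring
    _ = ∑ d ∈ D, ∑ d' ∈ D, C (∑ i, c i * (a i d * a i d')) * (X : ℂ[X]) ^ (d + d') := by
        rw [Finset.sum_comm]
        refine Finset.sum_congr rfl fun d _ => ?_
        rw [Finset.sum_comm]
        refine Finset.sum_congr rfl fun d' _ => ?_
        rw [map_sum, Finset.sum_mul]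

/-- **The pattern by frequency.**  With `N = 2k − 1`, `ζ` a primitive `N`-th root of unity and
`e_j = Σ_{n<N} (ζ^{j(N−1)})^n X^n`:
`Σ_i c_i w_i² = Σ_{j<N} (Σ_i (c_i/N) V_{ij}²) · e_j`, `V_{ij} = Σ_{d∈D} ρ_d(w_i)(ζ^j) X^d`. [folklore] -/
theorem pattern_by_frequency (D : Finset ℕ) (k : ℕ) (hk : 1 ≤ k)
    (hdirect : ∀ d ∈ D, ∀ h < k, ∀ d' ∈ D, ∀ h' < k, d + h = d' + h' → d = d')
    (r : ℕ) (c : Fin r → ℂ) (w : Fin r → ℂ[X])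
    (hw : ∀ i, (w i).support ⊆ (D ×ˢ range k).image (fun x => x.1 + x.2))
    (ρ : Fin r → ℕ → ℂ[X]) (hρ : ∀ i d, ρ i d = ∑ h ∈ range k, C ((w i).coeff (d + h)) * (X : ℂ[X]) ^ h)
    (ζ : ℂ) (hζ : IsPrimitiveRoot ζ (2 * k - 1)) :
    ∑ i, C (c i) * w i ^ 2 =
      ∑ j ∈ range (2 * k - 1),
        (∑ i, C (c i / ((2 * k - 1 : ℕ) : ℂ)) * (∑ d ∈ D, C ((ρ i d).eval (ζ ^ j)) * (X : ℂ[X]) ^ d) ^ 2) *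
          ∑ n ∈ range (2 * k - 1), C ((ζ ^ (j * (2 * k - 1 - 1))) ^ n) * (X : ℂ[X]) ^ n := by
  have hN : 0 < 2 * k - 1 := by omega
  rw [pattern_blocks D k hdirect r c w hw ρ hρ]
  -- Fourier inversion of every block
  have hG : ∀ d d', (∑ i, C (c i) * (ρ i d * ρ i d')) =
      ∑ j ∈ range (2 * k - 1), C ((∑ i, c i * ((ρ i d).eval (ζ ^ j) * (ρ i d').eval (ζ ^ j))) /
          ((2 * k - 1 : ℕ) : ℂ)) *
        ∑ n ∈ range (2 * k - 1), C ((ζ ^ (j * (2 * k - 1 - 1))) ^ n) * (X : ℂ[X]) ^ n := by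
    intro d d'
    conv_lhs => rw [dft_inversion (2 * k - 1) hN ζ hζ _ (natDegree_block_lt k hk r c w d d' ρ hρ)]
    simp only [eval_block]
  simp_rw [hG, sum_C_mul_sq_coeffPoly]
  -- regroup by frequency
  rw [Finset.sum_congr rfl fun d _ => Finset.sum_congr rfl fun d' _ => Finset.mul_sum _ _ _,
    Finset.sum_congr rfl fun d _ => Finset.sum_comm, Finset.sum_comm]
  refine Finset.sum_congr rfl fun j _ => ?_
  rw [Finset.sum_mul]
  refine Finset.sum_congr rfl fun d _ => ?_
  rw [Finset.sum_mul]
  refine Finset.sum_congr rfl fun d' _ => ?_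
  rw [Finset.sum_div, pow_add]
  simp only [div_eq_mul_inv]
  have : ∑ i, c i * ((ρ i d).eval (ζ ^ j) * (ρ i d').eval (ζ ^ j)) * ((2 * k - 1 : ℕ) : ℂ)⁻¹ =
      ∑ i, c i * ((2 * k - 1 : ℕ) : ℂ)⁻¹ * ((ρ i d).eval (ζ ^ j) * (ρ i d').eval (ζ ^ j)) :=
    Finset.sum_congr rfl fun i _ => by ring
  rw [this]
  ring

/-! ## The representation, priced by the Frobenius norms of the frequency slices -/

/-- **Direct-sumset representation (Frobenius form).**  For `k ≥ 1`, `D + [0,k)` direct, `S ⊇ D + [0,k)`,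
weighted squares `(c_i, w_i)_{i<r}` supported in `D + [0,k)`, and `ζ` a primitive `(2k−1)`-th root of unity:
there are weighted squares supported in `S` with the same pattern `Σ_i c_i w_i²` and mass
`≤ √r · (Nat.log 2 k + 5/2) · Σ_{j<2k−1} ‖C_j‖_F`,
`‖C_j‖_F² = Σ_{d,d'∈D} |Σ_i (c_i/(2k−1)) ρ_d(w_i)(ζ^j) ρ_{d'}(w_i)(ζ^j)|²`. [folklore] -/
theorem directSum_rep_frobenius (D : Finset ℕ) (k : ℕ) (hk : 1 ≤ k)
    (hdirect : ∀ d ∈ D, ∀ h < k, ∀ d' ∈ D, ∀ h' < k, d + h = d' + h' → d = d')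
    (S : Finset ℕ) (hS : ∀ d ∈ D, ∀ h < k, d + h ∈ S)
    (r : ℕ) (c : Fin r → ℂ) (w : Fin r → ℂ[X])
    (hw : ∀ i, (w i).support ⊆ (D ×ˢ range k).image (fun x => x.1 + x.2))
    (ρ : Fin r → ℕ → ℂ[X]) (hρ : ∀ i d, ρ i d = ∑ h ∈ range k, C ((w i).coeff (d + h)) * (X : ℂ[X]) ^ h)
    (ζ : ℂ) (hζ : IsPrimitiveRoot ζ (2 * k - 1)) :
    ∃ (s : ℕ) (c' : Fin s → ℂ) (w' : Fin s → ℂ[X]), (∀ j, (w' j).support ⊆ S) ∧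
      (∑ j, C (c' j) * w' j ^ 2) = ∑ i, C (c i) * w i ^ 2 ∧
      (∑ j, sqMass (c' j) (w' j)) ≤ Real.sqrt r * ((Nat.log 2 k : ℝ) + 5 / 2) *
        ∑ j ∈ range (2 * k - 1), Real.sqrt (∑ d ∈ D, ∑ d' ∈ D,
          ‖∑ i, c i / ((2 * k - 1 : ℕ) : ℂ) * ((ρ i d).eval (ζ ^ j) * (ρ i d').eval (ζ ^ j))‖ ^ 2) := by
  classical
  have hN : 0 < 2 * k - 1 := by omega
  have hζ1 : ‖ζ‖ = 1 := hζ.norm'_eq_one hN.ne'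
  -- properness of `D + [0,k)` in the form `rep_mul` wants
  have hprop : ∀ a₁ ∈ D, ∀ b₁ ∈ range k, ∀ a₂ ∈ D, ∀ b₂ ∈ range k, a₁ + b₁ = a₂ + b₂ → a₁ = a₂ :=
    fun a₁ ha₁ b₁ hb₁ a₂ ha₂ b₂ hb₂ h => hdirect a₁ ha₁ b₁ (mem_range.1 hb₁) a₂ ha₂ b₂ (mem_range.1 hb₂) h
  have hT : ∀ a ∈ D, ∀ b ∈ range k, a + b ∈ S := fun a ha b hb => hS a ha b (mem_range.1 hb)
  -- one frequency
  have hfreq : ∀ j ∈ range (2 * k - 1), ∃ (s : ℕ) (c' : Fin s → ℂ) (w' : Fin s → ℂ[X]),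
      (∀ l, (w' l).support ⊆ S) ∧
      (∑ l, C (c' l) * w' l ^ 2) =
        (∑ i, C (c i / ((2 * k - 1 : ℕ) : ℂ)) * (∑ d ∈ D, C ((ρ i d).eval (ζ ^ j)) * (X : ℂ[X]) ^ d) ^ 2) *
          ∑ n ∈ range (2 * k - 1), C ((ζ ^ (j * (2 * k - 1 - 1))) ^ n) * (X : ℂ[X]) ^ n ∧
      (∑ l, sqMass (c' l) (w' l)) ≤
        (Real.sqrt r * Real.sqrt (∑ d ∈ D, ∑ d' ∈ D,
          ‖∑ i, c i / ((2 * k - 1 : ℕ) : ℂ) * ((ρ i d).eval (ζ ^ j) * (ρ i d').eval (ζ ^ j))‖ ^ 2)) *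
        ((Nat.log 2 k : ℝ) + 5 / 2) := by
    intro j _
    have hu : ‖ζ ^ (j * (2 * k - 1 - 1))‖ = 1 := by rw [norm_pow, hζ1, one_pow]
    have hQ := lowRank_rep D r (fun i => c i / ((2 * k - 1 : ℕ) : ℂ))
      (fun i => ∑ d ∈ D, C ((ρ i d).eval (ζ ^ j)) * (X : ℂ[X]) ^ d)
      (fun i => support_sum_C_mul_X_pow_subset D _)
    have hQ' := rep_congr rfl (le_of_eq (?_ : _ = Real.sqrt r * Real.sqrt (∑ d ∈ D, ∑ d' ∈ D,
          ‖∑ i, c i / ((2 * k - 1 : ℕ) : ℂ) * ((ρ i d).eval (ζ ^ j) * (ρ i d').eval (ζ ^ j))‖ ^ 2))) hQ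
    · exact rep_mul hprop hT hQ' (exp_rep k hk _ hu)
    · congr 2
      refine Finset.sum_congr rfl fun d hd => Finset.sum_congr rfl fun d' hd' => ?_
      simp only [coeff_sum_C_mul_X_pow, if_pos hd, if_pos hd']
  have hall := rep_sum (range (2 * k - 1)) S _ _ hfreq
  refine rep_congr (pattern_by_frequency D k hk hdirect r c w hw ρ hρ ζ hζ).symm (le_of_eq ?_) hall
  rw [Finset.mul_sum]
  exact Finset.sum_congr rfl fun j _ => by ring

end

end Summit.ValiantsHypothesis.ValiantsHypothesis.Theorems.FeketeSOSHardPaleyRIP
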